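import Mathlib
import Summits.NavierStokesRegularity.NavierStokesRegularity.Theorems.FilamentSkeletonRssClause13FarOperatorSupWeightedSq
import Summits.NavierStokesRegularity.NavierStokesRegularity.Theorems.FilamentSkeletonRssClause13FarTailSup
import Summits.NavierStokesRegularity.NavierStokesRegularity.Theorems.FilamentSkeletonRssClause13TwoZoneFenceForced

/-!
# Clause 13-J/13-R, brick m3-w FAR PART (WEIGHTED): `‖Y_H(τ)‖ ≤ K(β₀K)·(M₀ + 4c_k^{ℓ,2}·S)·(1+|τ−c|/ℓ)^p` when `‖Y‖ ≤ S·(1+|·−c|/ℓ)^p`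

Route `FilamentSkeletonRss`, ∃-side clause 13 (`Clause13RNearStraightL`, stmt-NavierStokesRegularity-23612; typing-agnostic).  Design of record
rev 80–82 (m3; tenure R-m3b-2/3: "polynomial weights = bookkeeping of the OUTPUT weight `(1+|τ−c|)^b`") and lane memo
`DESIGN-28296-model-Linfty-g18.md` §3 (m3-w).  Weighted twin of `model_far_pointwise_right/left` (p720220): the bootstrap norm is the WEIGHTED sup
`‖Y(y)‖ ≤ S·ω(y)`, `ω(y) = (1+|y−c|/ℓ)^p` (`0 ≤ p ≤ 2` — the clause's `b_* ≈ 1 + 2β₀` exceeds `1`); then the commutator part of the far forcing is `≤ c_k^ℓ·S·ω(x)`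
(`norm_modelOperator_far_le_weighted_sq`) — it grows like the weight, which `twoZone_norm_le_forced_var(_left)` tolerates with `p_f = p`:
* §1 `weight_facts_ball` — `1 ≤ ω`; `ω ≤ 4` on `|τ−c| ≤ ℓ`; `ω(τ) ≤ 4ρ^p` and `ρ^p ≤ ω(τ)` outside (`ρ = |τ−c|/ℓ ≥ 1`);
* §2 ★ `model_far_pointwise_weighted_right` / ★ `model_far_pointwise_weighted_left` — on `[c, c+…]` / `[…, c]` with the damped zone
  `|τ−c| ≤ ℓ` and the amplified zone beyond:  `‖Y_H(τ)‖ ≤ K(β₀K)·(M₀ + 4c_k^{ℓ,2} S)·ω(τ)`, `M₀ = G·ε_X(1+‖k‖₁)N(Y) + (1+‖k‖₁)S_L + Λ·S_T`,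
  `K = ((1+k₂)/β₀)/(1−k₂)`, `k₂ = b₂q/(4G)`, `c_k^{ℓ,2} = Λ₂[(‖t²k′‖₁+‖tk‖₁) + 2(‖t³k′‖₁+‖t²k‖₁)/ℓ + (‖t⁴k′‖₁+‖t³k‖₁)/ℓ²] + (L₁+L₂)[‖tk‖₁ + 2‖t²k‖₁/ℓ + ‖t³k‖₁/ℓ²]`.
Lane ns-filament-19175-p1 g18; `--supports stmt-NavierStokesRegularity-23612 --as helper`.
HONEST FRAMING: an a-priori weighted estimate for an explicit 1-D model operator attached to a HYPOTHETICAL filament skeleton on the NEGATIVE side of a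
MODEL route; nothing here bears on Navier–Stokes regularity or blow-up; 23610/23612 stay OPEN.
-/

noncomputable section

open MeasureTheory Real Complex Filter Set
open scoped ComplexConjugate Topology
open Summit.NavierStokesRegularity.NavierStokesRegularity.Theorems.Clause13Transport (twoZone_norm_le_forced_var twoZone_norm_le_forced_var_left)

namespace Summit.NavierStokesRegularity.NavierStokesRegularity.Theorems.MatchedKernel
set_option linter.dupNamespace false

/-! ## §1 The weight on the ball -/

/-- **Weight facts** for `ω(τ) = (1+|τ−c|/ℓ)^p` (`ℓ > 0`, `0 ≤ p ≤ 2`): `1 ≤ ω`; `ω ≤ 4` on `|τ−c| ≤ ℓ`; outside, `ω ≤ 4ρ^p` and `ρ^p ≤ ω`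
(`ρ = (τ−c)/ℓ` resp. `(c−τ)/ℓ`, written with `c+ℓ−c` / `c−(c−ℓ)` to match the chain). [folklore] -/
theorem weight_facts_ball {ℓ p c : ℝ} (hℓ : 0 < ℓ) (hp0 : 0 ≤ p) (hp2 : p ≤ 2) (τ : ℝ) :
    1 ≤ (1 + |τ - c| / ℓ) ^ p ∧
    (|τ - c| ≤ ℓ → (1 + |τ - c| / ℓ) ^ p ≤ 4) ∧
    (c + ℓ ≤ τ → (1 + |τ - c| / ℓ) ^ p ≤ 4 * ((τ - c) / (c + ℓ - c)) ^ p ∧ ((τ - c) / (c + ℓ - c)) ^ p ≤ (1 + |τ - c| / ℓ) ^ p) ∧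
    (τ ≤ c - ℓ → (1 + |τ - c| / ℓ) ^ p ≤ 4 * ((c - τ) / (c - (c - ℓ))) ^ p ∧ ((c - τ) / (c - (c - ℓ))) ^ p ≤ (1 + |τ - c| / ℓ) ^ p) := by
  have hb1 : (1 : ℝ) ≤ 1 + |τ - c| / ℓ := le_add_of_nonneg_right (by positivity)
  have hle_sq : (1 + |τ - c| / ℓ) ^ p ≤ (1 + |τ - c| / ℓ) ^ 2 := by
    have h := Real.rpow_le_rpow_of_exponent_le hb1 hp2
    rw [show ((2 : ℝ)) = ((2 : ℕ) : ℝ) by norm_num, Real.rpow_natCast] at h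
    exact h
  have h2p : (2 : ℝ) ^ p ≤ 4 := by
    have h := Real.rpow_le_rpow_of_exponent_le (by norm_num : (1 : ℝ) ≤ 2) hp2
    rw [show ((2 : ℝ)) = ((2 : ℕ) : ℝ) by norm_num, Real.rpow_natCast] at h; norm_num at h; exact h
  refine ⟨Real.one_le_rpow hb1 hp0, fun h => ?_, fun h => ?_, fun h => ?_⟩
  · have hu : |τ - c| / ℓ ≤ 1 := by rw [div_le_one hℓ]; exact h
    have : (1 + |τ - c| / ℓ) ^ 2 ≤ 4 := by nlinarith [abs_nonneg (τ - c), div_nonneg (abs_nonneg (τ - c)) hℓ.le]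
    exact hle_sq.trans this
  · rw [show c + ℓ - c = ℓ by ring]
    have hτc : 0 ≤ τ - c := by linarith
    have habs : |τ - c| = τ - c := abs_of_nonneg hτc
    have hρ1 : 1 ≤ (τ - c) / ℓ := by rw [le_div_iff₀ hℓ]; linarith
    have hρ0 : 0 ≤ (τ - c) / ℓ := by positivity
    rw [habs]
    constructor
    · calc (1 + (τ - c) / ℓ) ^ p ≤ (2 * ((τ - c) / ℓ)) ^ p := Real.rpow_le_rpow (by positivity) (by linarith) hp0
        _ = 2 ^ p * ((τ - c) / ℓ) ^ p := Real.mul_rpow (by norm_num) hρ0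
        _ ≤ 4 * ((τ - c) / ℓ) ^ p := mul_le_mul_of_nonneg_right h2p (Real.rpow_nonneg hρ0 _)
    · exact Real.rpow_le_rpow hρ0 (by linarith) hp0
  · rw [show c - (c - ℓ) = ℓ by ring]
    have hτc : 0 ≤ c - τ := by linarith
    have habs : |τ - c| = c - τ := by rw [abs_sub_comm]; exact abs_of_nonneg hτc
    have hρ1 : 1 ≤ (c - τ) / ℓ := by rw [le_div_iff₀ hℓ]; linarith
    have hρ0 : 0 ≤ (c - τ) / ℓ := by positivity
    rw [habs]
    constructor
    · calc (1 + (c - τ) / ℓ) ^ p ≤ (2 * ((c - τ) / ℓ)) ^ p := Real.rpow_le_rpow (by positivity) (by linarith) hp0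
        _ = 2 ^ p * ((c - τ) / ℓ) ^ p := Real.mul_rpow (by norm_num) hρ0
        _ ≤ 4 * ((c - τ) / ℓ) ^ p := mul_le_mul_of_nonneg_right h2p (Real.rpow_nonneg hρ0 _)
    · exact Real.rpow_le_rpow hρ0 (by linarith) hp0

/-! ## §2 The far piece against the weighted sup, both sides -/

/-- ★ **FAR PIECE, WEIGHTED, RIGHT SIDE** (data as in `model_far_pointwise_right`, zone `[c, c+ℓ] ∪ [c+ℓ, b]`, plus `t²k, t³k′ ∈ L¹` and
`‖Y(y)‖ ≤ S·(1+|y−c|/ℓ)^p`, `S ≥ 0`, `0 ≤ p ≤ 2`): for `τ ∈ [c, b]`, `‖Y_H(τ)‖ ≤ K(β₀K)·(M₀ + 4c_k^{ℓ,2} S)·(1+|τ−c|/ℓ)^p`. [folklore] -/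
theorem model_far_pointwise_weighted_right {q G X : ℝ} (hq : 0 < q) (hG : 0 < G) (hX : 0 < X)
    {k k' : ℝ → ℝ} (hk : ∀ t, HasDerivAt k (k' t) t) (hk'c : Continuous k')
    (hki : Integrable k) (hk1 : Integrable fun t => t * k t) (hk2 : Integrable fun t => t ^ 2 * k t) (hk3 : Integrable fun t => t ^ 3 * k t)
    (hk'2 : Integrable fun t => t ^ 2 * k' t) (hk'3 : Integrable fun t => t ^ 3 * k' t) (hk'4 : Integrable fun t => t ^ 4 * k' t)
    {Mk : ℝ} (hkM : ∀ t, |k t| ≤ Mk)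
    {χ : ℝ → ℂ} (hkχ : ∀ z : ℝ, ∫ t : ℝ, ((k t : ℝ) : ℂ) * cexp (I * z * t) = χ z) (hfar : ∀ z : ℝ, χ z ≠ 1 → X ≤ |z| * √q)
    {Y : ℝ → ℂ} (hY : ContDiff ℝ 1 Y) (hYs : HasCompactSupport Y)
    {w : ℝ → ℝ} (hw : Differentiable ℝ w) (hw2 : Differentiable ℝ (deriv w)) {Λ Λ₂ : ℝ} (hΛ : ∀ t, |deriv w t| ≤ Λ)
    (hΛ₂ : ∀ t, |deriv (deriv w) t| ≤ Λ₂) {c ℓ b w₁ : ℝ} (hℓ : 0 < ℓ) (hℓb : c + ℓ ≤ b) (hw₁ : 0 < w₁)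
    (hwc : w c = 0) (hwpos : ∀ τ ∈ Icc c b, c < τ → 0 < w τ) (hww₁ : ∀ τ ∈ Icc (c + ℓ) b, w₁ * (τ - c) ≤ w τ)
    {β₁ β₂ β₂' : ℝ → ℂ} (hβ₁c : Continuous β₁) (hβ₂ : ∀ τ, HasDerivAt β₂ (β₂' τ) τ) {b₁ b₂ L₁ L₂ : ℝ}
    (hb₁ : ∀ τ, ‖β₁ τ‖ ≤ b₁) (hb₂ : ∀ τ, ‖β₂ τ‖ ≤ b₂) (hL₁ : ∀ x y, ‖β₁ y - β₁ x‖ ≤ L₁ * |y - x|)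
    (hL₂ : ∀ x y, ‖β₂ y - β₂ x‖ ≤ L₂ * |y - x|) (hsmall : b₂ ≤ 2 * G / q)
    {β₀ p : ℝ} (hβ₀ : 0 < β₀) (hp0 : 0 ≤ p) (hp2 : p ≤ 2)
    (hgain : ∀ τ ∈ Icc c (c + ℓ), β₀ ≤ -(β₁ τ).re
      - (b₂ / (2 * (2 * G / q))) / (1 - b₂ / (2 * (2 * G / q))) * (2 * |(β₁ τ).im| + b₂ / (2 * (2 * G / q)) * ‖β₂ τ‖)
      - (w τ * ‖β₂' τ‖ / (2 * (2 * G / q))) / (1 - b₂ / (2 * (2 * G / q))))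
    (hstag : β₀ ≤ 2 * G / q - ‖β₁ c‖ - ‖β₂ c‖)
    (hgrow : ∀ τ ∈ Icc (c + ℓ) b, (β₁ τ).re + β₀
      + (b₂ / (2 * (2 * G / q))) / (1 - b₂ / (2 * (2 * G / q))) * (2 * |(β₁ τ).im| + b₂ / (2 * (2 * G / q)) * ‖β₂ τ‖)
      + (w τ * ‖β₂' τ‖ / (2 * (2 * G / q))) / (1 - b₂ / (2 * (2 * G / q))) ≤ p * w₁)
    {SL ST S : ℝ} (hS : 0 ≤ S)
    (hSL : ∀ y : ℝ, ‖I * (G : ℂ) * ((2 / q : ℂ) * Y y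
          - ∫ σ : ℝ, ((((2 * q - (y - σ) ^ 2) * (((y - σ) ^ 2 + q) ^ (5 / 2 : ℝ))⁻¹ : ℝ)) : ℂ) * Y σ)
        - ((w y : ℝ) : ℂ) * deriv Y y + β₁ y * Y y + β₂ y * conj (Y y)‖ ≤ SL)
    (hSY : ∀ y : ℝ, ‖Y y‖ ≤ S * (1 + |y - c| / ℓ) ^ p)
    (hST : ∀ x ∈ Icc c b, ‖∫ y : ℝ, (((x - y) * k' (x - y) + k (x - y) : ℝ) : ℂ) * Y y‖ ≤ ST) :
    ∀ τ ∈ Icc c b, ‖Y τ - ∫ y : ℝ, ((k (τ - y) : ℝ) : ℂ) * Y y‖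
      ≤ (((1 + b₂ / (2 * (2 * G / q))) / β₀) / (1 - b₂ / (2 * (2 * G / q))))
        * (β₀ * (((1 + b₂ / (2 * (2 * G / q))) / β₀) / (1 - b₂ / (2 * (2 * G / q)))))
        * ((G * (10 / (q * Real.sqrt (π * √q)) * Real.exp (-(X / 2)) * (1 + ∫ t, |k t|) * (∫ x : ℝ, ‖Y x‖ ^ 2) ^ (1 / 2 : ℝ))
            + ((1 + ∫ t, |k t|) * SL + Λ * ST))
          + 4 * (Λ₂ * (((∫ t, t ^ 2 * |k' t|) + (∫ t, |t| * |k t|))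
              + 2 * ((∫ t, |t| ^ 3 * |k' t|) + (∫ t, t ^ 2 * |k t|)) / ℓ
              + ((∫ t, t ^ 4 * |k' t|) + (∫ t, |t| ^ 3 * |k t|)) / ℓ ^ 2)
            + (L₁ + L₂) * ((∫ t, |t| * |k t|) + 2 * (∫ t, t ^ 2 * |k t|) / ℓ + (∫ t, |t| ^ 3 * |k t|) / ℓ ^ 2)) * S)
        * (1 + |τ - c| / ℓ) ^ p := by
  have hkc : Continuous k := continuous_iff_continuousAt.2 fun t => (hk t).continuousAt
  have hβ₂c : Continuous β₂ := continuous_iff_continuousAt.2 fun t => (hβ₂ t).continuousAt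
  have hGq : 0 < 2 * G / q := by positivity
  have hb20 : 0 ≤ b₂ := (norm_nonneg _).trans (hb₂ 0)
  have hΛ0 : 0 ≤ Λ := (abs_nonneg _).trans (hΛ 0)
  have hk2' : b₂ / (2 * (2 * G / q)) ≤ 1 / 2 := by rw [div_le_iff₀ (by positivity)]; linarith
  have h1k : 0 < 1 - b₂ / (2 * (2 * G / q)) := by linarith
  have hcd : c < c + ℓ := by linarith
  have hc : c ∈ Icc c b := left_mem_Icc.2 (hcd.le.trans hℓb)
  set K : ℝ := ((1 + b₂ / (2 * (2 * G / q))) / β₀) / (1 - b₂ / (2 * (2 * G / q))) with hKdef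
  have hK0 : 0 < K := by positivity
  have hβ₀K : 1 ≤ β₀ * K := by
    simp only [hKdef]
    rw [show β₀ * ((1 + b₂ / (2 * (2 * G / q))) / β₀ / (1 - b₂ / (2 * (2 * G / q))))
      = (1 + b₂ / (2 * (2 * G / q))) / (1 - b₂ / (2 * (2 * G / q))) by field_simp]
    rw [le_div_iff₀ h1k]
    linarith [show 0 ≤ b₂ / (2 * (2 * G / q)) by positivity]
  set M0 : ℝ := (G * (10 / (q * Real.sqrt (π * √q)) * Real.exp (-(X / 2)) * (1 + ∫ t, |k t|) * (∫ x : ℝ, ‖Y x‖ ^ 2) ^ (1 / 2 : ℝ))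
            + ((1 + ∫ t, |k t|) * SL + Λ * ST)) with hM0
  set ck : ℝ := Λ₂ * (((∫ t, t ^ 2 * |k' t|) + (∫ t, |t| * |k t|))
              + 2 * ((∫ t, |t| ^ 3 * |k' t|) + (∫ t, t ^ 2 * |k t|)) / ℓ
              + ((∫ t, t ^ 4 * |k' t|) + (∫ t, |t| ^ 3 * |k t|)) / ℓ ^ 2)
            + (L₁ + L₂) * ((∫ t, |t| * |k t|) + 2 * (∫ t, t ^ 2 * |k t|) / ℓ + (∫ t, |t| ^ 3 * |k t|) / ℓ ^ 2) with hck
  set z : ℝ → ℂ := fun x => Y x - ∫ y : ℝ, ((k (x - y) : ℝ) : ℂ) * Y y with hzdef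
  set z' : ℝ → ℂ := fun x => deriv Y x - ∫ y : ℝ, ((k (x - y) : ℝ) : ℂ) * deriv Y y with hz'def
  set f : ℝ → ℂ := fun x =>
    (-(I * (G : ℂ) * ∫ σ : ℝ, ((((2 * q - (x - σ) ^ 2) * (((x - σ) ^ 2 + q) ^ (5 / 2 : ℝ))⁻¹ : ℝ)) : ℂ)
              * (Y σ - ∫ y : ℝ, ((k (σ - y) : ℝ) : ℂ) * Y y))
        - (I * (G : ℂ) * ((2 / q : ℂ) * (Y x - ∫ y : ℝ, ((k (x - y) : ℝ) : ℂ) * Y y)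
            - ∫ σ : ℝ, ((((2 * q - (x - σ) ^ 2) * (((x - σ) ^ 2 + q) ^ (5 / 2 : ℝ))⁻¹ : ℝ)) : ℂ)
                * (Y σ - ∫ y : ℝ, ((k (σ - y) : ℝ) : ℂ) * Y y))
          - ((w x : ℝ) : ℂ) * (deriv Y x - ∫ y : ℝ, ((k (x - y) : ℝ) : ℂ) * deriv Y y)
          + β₁ x * (Y x - ∫ y : ℝ, ((k (x - y) : ℝ) : ℂ) * Y y) + β₂ x * conj (Y x - ∫ y : ℝ, ((k (x - y) : ℝ) : ℂ) * Y y))) with hfdef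
  have hz : ∀ τ ∈ Icc c b, HasDerivAt z (z' τ) τ := fun τ _ => hasDerivAt_far hkc hY hYs τ
  have hode : ∀ τ ∈ Icc c b, (w τ : ℂ) * z' τ = I * ((2 * G / q : ℝ) : ℂ) * z τ + β₁ τ * z τ + β₂ τ * conj (z τ) + f τ :=
    fun τ _ => far_transport_ode q G hq k Y w β₁ β₂ τ
  have hfx : ∀ x ∈ Icc c b, ‖f x‖ ≤ M0 + ck * S * (1 + |x - c| / ℓ) ^ p := by
    intro x hx
    have htail := (norm_smoothingPiece_far_le hq hX hkc hki hkM hkχ hfar hY hYs x).2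
    have hop := norm_modelOperator_far_le_weighted_sq (G := G) hq hk hk'c hki hk1 hk2 hk3 hk'2 hk'3 hk'4 hkM hY hYs hw hw2 hΛ hΛ₂ hβ₁c hβ₂c
      hb₁ hb₂ hL₁ hL₂ hS hℓ hp0 hp2 hSL hSY x
    refine (norm_far_forcing_le hG.le _ _).trans ?_
    have h1 := mul_le_mul_of_nonneg_left htail hG.le
    have h2 := mul_le_mul_of_nonneg_left (hST x hx) hΛ0
    simp only [hM0, hck]
    linarith [hop]
  have hSLnn : 0 ≤ SL := (norm_nonneg _).trans (hSL 0)
  have hSTnn : 0 ≤ ST := (norm_nonneg _).trans (hST c hc)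
  have hkint0 : 0 ≤ ∫ t, |k t| := integral_nonneg fun t => abs_nonneg _
  have hM00 : 0 ≤ M0 := by
    have h1 : 0 ≤ 10 / (q * Real.sqrt (π * √q)) * Real.exp (-(X / 2)) * (1 + ∫ t, |k t|) * (∫ x : ℝ, ‖Y x‖ ^ 2) ^ (1 / 2 : ℝ) :=
      mul_nonneg (mul_nonneg (mul_nonneg (by positivity) (Real.exp_nonneg _)) (by linarith)) (by positivity)
    simp only [hM0]; nlinarith [mul_nonneg hG.le h1, mul_nonneg (by linarith : (0:ℝ) ≤ 1 + ∫ t, |k t|) hSLnn, mul_nonneg hΛ0 hSTnn]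
  have hL1 : 0 ≤ L₁ := by have := hL₁ 0 1; rw [sub_zero, abs_one, mul_one] at this; exact (norm_nonneg _).trans this
  have hL2 : 0 ≤ L₂ := by have := hL₂ 0 1; rw [sub_zero, abs_one, mul_one] at this; exact (norm_nonneg _).trans this
  have hΛ20 : 0 ≤ Λ₂ := (abs_nonneg _).trans (hΛ₂ 0)
  have hI1 : 0 ≤ ∫ t, t ^ 2 * |k' t| := integral_nonneg fun t => by positivity
  have hI2 : 0 ≤ ∫ t, |t| * |k t| := integral_nonneg fun t => by positivity
  have hI3 : 0 ≤ ∫ t, |t| ^ 3 * |k' t| := integral_nonneg fun t => by positivity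
  have hI4 : 0 ≤ ∫ t, t ^ 2 * |k t| := integral_nonneg fun t => by positivity
  have hI5 : 0 ≤ ∫ t, t ^ 4 * |k' t| := integral_nonneg fun t => by positivity
  have hI6 : 0 ≤ ∫ t, |t| ^ 3 * |k t| := integral_nonneg fun t => by positivity
  have hck0 : 0 ≤ ck := by
    simp only [hck]
    apply add_nonneg
    · refine mul_nonneg hΛ20 (add_nonneg (add_nonneg (add_nonneg hI1 hI2) ?_) (div_nonneg (add_nonneg hI5 hI6) (sq_nonneg ℓ)))
      exact div_nonneg (mul_nonneg zero_le_two (add_nonneg hI3 hI4)) hℓ.le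
    · refine mul_nonneg (add_nonneg hL1 hL2) (add_nonneg (add_nonneg hI2 ?_) (div_nonneg hI6 (sq_nonneg ℓ)))
      exact div_nonneg (mul_nonneg zero_le_two hI4) hℓ.le
  have hckS : 0 ≤ ck * S := mul_nonneg hck0 hS
  set M : ℝ := M0 + 4 * ck * S with hMdef
  have hM0' : 0 ≤ M := by
    simp only [hMdef]
    have : 0 ≤ 4 * ck * S := by rw [mul_assoc]; exact mul_nonneg (by norm_num) hckS
    linarith
  have hfd : ∀ τ ∈ Icc c (c + ℓ), ‖f τ‖ ≤ M := by
    intro τ hτ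
    have hω := (weight_facts_ball (c := c) hℓ hp0 hp2 τ).2.1 (by rw [abs_of_nonneg (by linarith [hτ.1])]; linarith [hτ.2])
    have h := hfx τ ⟨hτ.1, hτ.2.trans hℓb⟩
    have h2 : ck * S * (1 + |τ - c| / ℓ) ^ p ≤ ck * S * 4 := mul_le_mul_of_nonneg_left hω hckS
    calc ‖f τ‖ ≤ M0 + ck * S * (1 + |τ - c| / ℓ) ^ p := h
      _ ≤ M0 + ck * S * 4 := by linarith
      _ = M := by simp only [hMdef]; ring
  have hfa : ∀ τ ∈ Icc (c + ℓ) b, ‖f τ‖ ≤ M * ((τ - c) / (c + ℓ - c)) ^ p := by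
    intro τ hτ
    have hwf := (weight_facts_ball (c := c) hℓ hp0 hp2 τ).2.2.1 hτ.1
    have hρ1 : 1 ≤ ((τ - c) / (c + ℓ - c)) ^ p :=
      Real.one_le_rpow (by rw [show c + ℓ - c = ℓ by ring, le_div_iff₀ hℓ]; linarith [hτ.1]) hp0
    have h := hfx τ ⟨hcd.le.trans hτ.1, hτ.2⟩
    have h2 : ck * S * (1 + |τ - c| / ℓ) ^ p ≤ ck * S * (4 * ((τ - c) / (c + ℓ - c)) ^ p) := mul_le_mul_of_nonneg_left hwf.1 hckS
    have h3 : M0 ≤ M0 * ((τ - c) / (c + ℓ - c)) ^ p := le_mul_of_one_le_right hM00 hρ1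
    calc ‖f τ‖ ≤ M0 + ck * S * (1 + |τ - c| / ℓ) ^ p := h
      _ ≤ M0 * ((τ - c) / (c + ℓ - c)) ^ p + ck * S * (4 * ((τ - c) / (c + ℓ - c)) ^ p) := add_le_add h3 h2
      _ = M * ((τ - c) / (c + ℓ - c)) ^ p := by simp only [hMdef]; ring
  have hwpos' : ∀ τ ∈ Ioc c b, 0 < w τ := fun τ hτ => hwpos τ ⟨hτ.1.le, hτ.2⟩ hτ.1
  have h := twoZone_norm_le_forced_var (z := z) (z' := z') (f := f) (α := β₁) (β := β₂) (β' := β₂') (G := 2 * G / q) (βmax := b₂)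
    (pf := p) hGq hM0' hβ₀ hb20 hcd hℓb hw₁ hp0 le_rfl hz (fun τ _ => hβ₂ τ) hw.continuous hwc hwpos' hww₁ hode hfd hfa
    (fun τ _ => hb₂ τ) hsmall hgain hstag hgrow
  intro τ hτ
  have hw1 := (weight_facts_ball (c := c) hℓ hp0 hp2 τ).1
  rcases le_or_gt τ (c + ℓ) with h1 | h1
  · have hd := h.1 τ ⟨hτ.1, h1⟩
    refine hd.trans ?_
    have : K * M ≤ K * (β₀ * K) * M * (1 + |τ - c| / ℓ) ^ p := by
      have e : K * (β₀ * K) * M * (1 + |τ - c| / ℓ) ^ p = K * M * ((β₀ * K) * (1 + |τ - c| / ℓ) ^ p) := by ring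
      rw [e]
      have h2 : (1 : ℝ) ≤ (β₀ * K) * (1 + |τ - c| / ℓ) ^ p := one_le_mul_of_one_le_of_one_le hβ₀K hw1
      have h3 : 0 ≤ K * M := mul_nonneg hK0.le hM0'
      exact le_mul_of_one_le_right h3 h2
    simpa only [hKdef, hMdef] using this
  · have ha := h.2 τ ⟨h1.le, hτ.2⟩
    refine ha.trans ?_
    have hρω := ((weight_facts_ball (c := c) hℓ hp0 hp2 τ).2.2.1 h1.le).2
    have h3 : 0 ≤ K * (β₀ * K * M) := mul_nonneg hK0.le (mul_nonneg (mul_nonneg hβ₀.le hK0.le) hM0')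
    have := mul_le_mul_of_nonneg_right hρω h3
    have e : (1 + |τ - c| / ℓ) ^ p * (K * (β₀ * K * M)) = K * (β₀ * K) * M * (1 + |τ - c| / ℓ) ^ p := by ring
    rw [e] at this
    simpa only [hKdef, hMdef] using this

/-- **FAR PIECE, WEIGHTED, LEFT SIDE** (mirror: zone `[b, c−ℓ] ∪ [c−ℓ, c]`, `b ≤ c − ℓ`, `w < 0` on `[b, c)`, `−w ≥ w₁(c−τ)` on `[b, c−ℓ]`), with `t²k, t³k′ ∈ L¹`
and the weighted hypothesis `‖Y(y)‖ ≤ S·(1+|y−c|/ℓ)^p` (`S ≥ 0`, `0 ≤ p ≤ 2`).  Then for `τ ∈ [b, c]`: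
`‖Y_H(τ)‖ ≤ K(β₀K)·(M₀ + 4c_k^{ℓ,2} S)·(1+|τ−c|/ℓ)^p`, `M₀ = G·ε_X(1+‖k‖₁)N(Y) + (1+‖k‖₁)S_L + Λ·S_T`. [folklore] -/
theorem model_far_pointwise_weighted_left {q G X : ℝ} (hq : 0 < q) (hG : 0 < G) (hX : 0 < X)
    {k k' : ℝ → ℝ} (hk : ∀ t, HasDerivAt k (k' t) t) (hk'c : Continuous k')
    (hki : Integrable k) (hk1 : Integrable fun t => t * k t) (hk2 : Integrable fun t => t ^ 2 * k t) (hk3 : Integrable fun t => t ^ 3 * k t)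
    (hk'2 : Integrable fun t => t ^ 2 * k' t) (hk'3 : Integrable fun t => t ^ 3 * k' t) (hk'4 : Integrable fun t => t ^ 4 * k' t)
    {Mk : ℝ} (hkM : ∀ t, |k t| ≤ Mk)
    {χ : ℝ → ℂ} (hkχ : ∀ z : ℝ, ∫ t : ℝ, ((k t : ℝ) : ℂ) * cexp (I * z * t) = χ z) (hfar : ∀ z : ℝ, χ z ≠ 1 → X ≤ |z| * √q)
    {Y : ℝ → ℂ} (hY : ContDiff ℝ 1 Y) (hYs : HasCompactSupport Y)
    {w : ℝ → ℝ} (hw : Differentiable ℝ w) (hw2 : Differentiable ℝ (deriv w)) {Λ Λ₂ : ℝ} (hΛ : ∀ t, |deriv w t| ≤ Λ)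
    (hΛ₂ : ∀ t, |deriv (deriv w) t| ≤ Λ₂) {c ℓ b w₁ : ℝ} (hℓ : 0 < ℓ) (hℓb : b ≤ c - ℓ) (hw₁ : 0 < w₁)
    (hwc : w c = 0) (hwneg : ∀ τ ∈ Icc b c, τ < c → w τ < 0) (hww₁ : ∀ τ ∈ Icc b (c - ℓ), w₁ * (c - τ) ≤ -w τ)
    {β₁ β₂ β₂' : ℝ → ℂ} (hβ₁c : Continuous β₁) (hβ₂ : ∀ τ, HasDerivAt β₂ (β₂' τ) τ) {b₁ b₂ L₁ L₂ : ℝ}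
    (hb₁ : ∀ τ, ‖β₁ τ‖ ≤ b₁) (hb₂ : ∀ τ, ‖β₂ τ‖ ≤ b₂) (hL₁ : ∀ x y, ‖β₁ y - β₁ x‖ ≤ L₁ * |y - x|)
    (hL₂ : ∀ x y, ‖β₂ y - β₂ x‖ ≤ L₂ * |y - x|) (hsmall : b₂ ≤ 2 * G / q)
    {β₀ p : ℝ} (hβ₀ : 0 < β₀) (hp0 : 0 ≤ p) (hp2 : p ≤ 2)
    (hgain : ∀ τ ∈ Icc (c - ℓ) c, β₀ ≤ -(β₁ τ).re
      - (b₂ / (2 * (2 * G / q))) / (1 - b₂ / (2 * (2 * G / q))) * (2 * |(β₁ τ).im| + b₂ / (2 * (2 * G / q)) * ‖β₂ τ‖)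
      - (-w τ * ‖β₂' τ‖ / (2 * (2 * G / q))) / (1 - b₂ / (2 * (2 * G / q))))
    (hstag : β₀ ≤ 2 * G / q - ‖β₁ c‖ - ‖β₂ c‖)
    (hgrow : ∀ τ ∈ Icc b (c - ℓ), (β₁ τ).re + β₀
      + (b₂ / (2 * (2 * G / q))) / (1 - b₂ / (2 * (2 * G / q))) * (2 * |(β₁ τ).im| + b₂ / (2 * (2 * G / q)) * ‖β₂ τ‖)
      + (-w τ * ‖β₂' τ‖ / (2 * (2 * G / q))) / (1 - b₂ / (2 * (2 * G / q))) ≤ p * w₁)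
    {SL ST S : ℝ} (hS : 0 ≤ S)
    (hSL : ∀ y : ℝ, ‖I * (G : ℂ) * ((2 / q : ℂ) * Y y
          - ∫ σ : ℝ, ((((2 * q - (y - σ) ^ 2) * (((y - σ) ^ 2 + q) ^ (5 / 2 : ℝ))⁻¹ : ℝ)) : ℂ) * Y σ)
        - ((w y : ℝ) : ℂ) * deriv Y y + β₁ y * Y y + β₂ y * conj (Y y)‖ ≤ SL)
    (hSY : ∀ y : ℝ, ‖Y y‖ ≤ S * (1 + |y - c| / ℓ) ^ p)
    (hST : ∀ x ∈ Icc b c, ‖∫ y : ℝ, (((x - y) * k' (x - y) + k (x - y) : ℝ) : ℂ) * Y y‖ ≤ ST) :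
    ∀ τ ∈ Icc b c, ‖Y τ - ∫ y : ℝ, ((k (τ - y) : ℝ) : ℂ) * Y y‖
      ≤ (((1 + b₂ / (2 * (2 * G / q))) / β₀) / (1 - b₂ / (2 * (2 * G / q))))
        * (β₀ * (((1 + b₂ / (2 * (2 * G / q))) / β₀) / (1 - b₂ / (2 * (2 * G / q)))))
        * ((G * (10 / (q * Real.sqrt (π * √q)) * Real.exp (-(X / 2)) * (1 + ∫ t, |k t|) * (∫ x : ℝ, ‖Y x‖ ^ 2) ^ (1 / 2 : ℝ))
            + ((1 + ∫ t, |k t|) * SL + Λ * ST))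
          + 4 * (Λ₂ * (((∫ t, t ^ 2 * |k' t|) + (∫ t, |t| * |k t|))
              + 2 * ((∫ t, |t| ^ 3 * |k' t|) + (∫ t, t ^ 2 * |k t|)) / ℓ
              + ((∫ t, t ^ 4 * |k' t|) + (∫ t, |t| ^ 3 * |k t|)) / ℓ ^ 2)
            + (L₁ + L₂) * ((∫ t, |t| * |k t|) + 2 * (∫ t, t ^ 2 * |k t|) / ℓ + (∫ t, |t| ^ 3 * |k t|) / ℓ ^ 2)) * S)
        * (1 + |τ - c| / ℓ) ^ p := by
  have hkc : Continuous k := continuous_iff_continuousAt.2 fun t => (hk t).continuousAt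
  have hβ₂c : Continuous β₂ := continuous_iff_continuousAt.2 fun t => (hβ₂ t).continuousAt
  have hGq : 0 < 2 * G / q := by positivity
  have hb20 : 0 ≤ b₂ := (norm_nonneg _).trans (hb₂ 0)
  have hΛ0 : 0 ≤ Λ := (abs_nonneg _).trans (hΛ 0)
  have hk2' : b₂ / (2 * (2 * G / q)) ≤ 1 / 2 := by rw [div_le_iff₀ (by positivity)]; linarith
  have h1k : 0 < 1 - b₂ / (2 * (2 * G / q)) := by linarith
  have hec : c - ℓ < c := by linarith
  have hc : c ∈ Icc b c := right_mem_Icc.2 (hℓb.trans hec.le)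
  set K : ℝ := ((1 + b₂ / (2 * (2 * G / q))) / β₀) / (1 - b₂ / (2 * (2 * G / q))) with hKdef
  have hK0 : 0 < K := by positivity
  have hβ₀K : 1 ≤ β₀ * K := by
    simp only [hKdef]
    rw [show β₀ * ((1 + b₂ / (2 * (2 * G / q))) / β₀ / (1 - b₂ / (2 * (2 * G / q))))
      = (1 + b₂ / (2 * (2 * G / q))) / (1 - b₂ / (2 * (2 * G / q))) by field_simp]
    rw [le_div_iff₀ h1k]
    linarith [show 0 ≤ b₂ / (2 * (2 * G / q)) by positivity]
  set M0 : ℝ := (G * (10 / (q * Real.sqrt (π * √q)) * Real.exp (-(X / 2)) * (1 + ∫ t, |k t|) * (∫ x : ℝ, ‖Y x‖ ^ 2) ^ (1 / 2 : ℝ))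
            + ((1 + ∫ t, |k t|) * SL + Λ * ST)) with hM0
  set ck : ℝ := Λ₂ * (((∫ t, t ^ 2 * |k' t|) + (∫ t, |t| * |k t|))
              + 2 * ((∫ t, |t| ^ 3 * |k' t|) + (∫ t, t ^ 2 * |k t|)) / ℓ
              + ((∫ t, t ^ 4 * |k' t|) + (∫ t, |t| ^ 3 * |k t|)) / ℓ ^ 2)
            + (L₁ + L₂) * ((∫ t, |t| * |k t|) + 2 * (∫ t, t ^ 2 * |k t|) / ℓ + (∫ t, |t| ^ 3 * |k t|) / ℓ ^ 2) with hck
  set z : ℝ → ℂ := fun x => Y x - ∫ y : ℝ, ((k (x - y) : ℝ) : ℂ) * Y y with hzdef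
  set z' : ℝ → ℂ := fun x => deriv Y x - ∫ y : ℝ, ((k (x - y) : ℝ) : ℂ) * deriv Y y with hz'def
  set f : ℝ → ℂ := fun x =>
    (-(I * (G : ℂ) * ∫ σ : ℝ, ((((2 * q - (x - σ) ^ 2) * (((x - σ) ^ 2 + q) ^ (5 / 2 : ℝ))⁻¹ : ℝ)) : ℂ)
              * (Y σ - ∫ y : ℝ, ((k (σ - y) : ℝ) : ℂ) * Y y))
        - (I * (G : ℂ) * ((2 / q : ℂ) * (Y x - ∫ y : ℝ, ((k (x - y) : ℝ) : ℂ) * Y y)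
            - ∫ σ : ℝ, ((((2 * q - (x - σ) ^ 2) * (((x - σ) ^ 2 + q) ^ (5 / 2 : ℝ))⁻¹ : ℝ)) : ℂ)
                * (Y σ - ∫ y : ℝ, ((k (σ - y) : ℝ) : ℂ) * Y y))
          - ((w x : ℝ) : ℂ) * (deriv Y x - ∫ y : ℝ, ((k (x - y) : ℝ) : ℂ) * deriv Y y)
          + β₁ x * (Y x - ∫ y : ℝ, ((k (x - y) : ℝ) : ℂ) * Y y) + β₂ x * conj (Y x - ∫ y : ℝ, ((k (x - y) : ℝ) : ℂ) * Y y))) with hfdef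
  have hz : ∀ τ ∈ Icc b c, HasDerivAt z (z' τ) τ := fun τ _ => hasDerivAt_far hkc hY hYs τ
  have hode : ∀ τ ∈ Icc b c, (w τ : ℂ) * z' τ = I * ((2 * G / q : ℝ) : ℂ) * z τ + β₁ τ * z τ + β₂ τ * conj (z τ) + f τ :=
    fun τ _ => far_transport_ode q G hq k Y w β₁ β₂ τ
  have hfx : ∀ x ∈ Icc b c, ‖f x‖ ≤ M0 + ck * S * (1 + |x - c| / ℓ) ^ p := by
    intro x hx
    have htail := (norm_smoothingPiece_far_le hq hX hkc hki hkM hkχ hfar hY hYs x).2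
    have hop := norm_modelOperator_far_le_weighted_sq (G := G) hq hk hk'c hki hk1 hk2 hk3 hk'2 hk'3 hk'4 hkM hY hYs hw hw2 hΛ hΛ₂ hβ₁c hβ₂c
      hb₁ hb₂ hL₁ hL₂ hS hℓ hp0 hp2 hSL hSY x
    refine (norm_far_forcing_le hG.le _ _).trans ?_
    have h1 := mul_le_mul_of_nonneg_left htail hG.le
    have h2 := mul_le_mul_of_nonneg_left (hST x hx) hΛ0
    simp only [hM0, hck]
    linarith [hop]
  have hSLnn : 0 ≤ SL := (norm_nonneg _).trans (hSL 0)
  have hSTnn : 0 ≤ ST := (norm_nonneg _).trans (hST c hc)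
  have hkint0 : 0 ≤ ∫ t, |k t| := integral_nonneg fun t => abs_nonneg _
  have hM00 : 0 ≤ M0 := by
    have h1 : 0 ≤ 10 / (q * Real.sqrt (π * √q)) * Real.exp (-(X / 2)) * (1 + ∫ t, |k t|) * (∫ x : ℝ, ‖Y x‖ ^ 2) ^ (1 / 2 : ℝ) :=
      mul_nonneg (mul_nonneg (mul_nonneg (by positivity) (Real.exp_nonneg _)) (by linarith)) (by positivity)
    simp only [hM0]; nlinarith [mul_nonneg hG.le h1, mul_nonneg (by linarith : (0:ℝ) ≤ 1 + ∫ t, |k t|) hSLnn, mul_nonneg hΛ0 hSTnn]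
  have hL1 : 0 ≤ L₁ := by have := hL₁ 0 1; rw [sub_zero, abs_one, mul_one] at this; exact (norm_nonneg _).trans this
  have hL2 : 0 ≤ L₂ := by have := hL₂ 0 1; rw [sub_zero, abs_one, mul_one] at this; exact (norm_nonneg _).trans this
  have hΛ20 : 0 ≤ Λ₂ := (abs_nonneg _).trans (hΛ₂ 0)
  have hI1 : 0 ≤ ∫ t, t ^ 2 * |k' t| := integral_nonneg fun t => by positivity
  have hI2 : 0 ≤ ∫ t, |t| * |k t| := integral_nonneg fun t => by positivity
  have hI3 : 0 ≤ ∫ t, |t| ^ 3 * |k' t| := integral_nonneg fun t => by positivity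
  have hI4 : 0 ≤ ∫ t, t ^ 2 * |k t| := integral_nonneg fun t => by positivity
  have hI5 : 0 ≤ ∫ t, t ^ 4 * |k' t| := integral_nonneg fun t => by positivity
  have hI6 : 0 ≤ ∫ t, |t| ^ 3 * |k t| := integral_nonneg fun t => by positivity
  have hck0 : 0 ≤ ck := by
    simp only [hck]
    apply add_nonneg
    · refine mul_nonneg hΛ20 (add_nonneg (add_nonneg (add_nonneg hI1 hI2) ?_) (div_nonneg (add_nonneg hI5 hI6) (sq_nonneg ℓ)))
      exact div_nonneg (mul_nonneg zero_le_two (add_nonneg hI3 hI4)) hℓ.le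
    · refine mul_nonneg (add_nonneg hL1 hL2) (add_nonneg (add_nonneg hI2 ?_) (div_nonneg hI6 (sq_nonneg ℓ)))
      exact div_nonneg (mul_nonneg zero_le_two hI4) hℓ.le
  have hckS : 0 ≤ ck * S := mul_nonneg hck0 hS
  set M : ℝ := M0 + 4 * ck * S with hMdef
  have hM0' : 0 ≤ M := by
    simp only [hMdef]
    have : 0 ≤ 4 * ck * S := by rw [mul_assoc]; exact mul_nonneg (by norm_num) hckS
    linarith
  have hfd : ∀ τ ∈ Icc (c - ℓ) c, ‖f τ‖ ≤ M := by
    intro τ hτ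
    have hω := (weight_facts_ball (c := c) hℓ hp0 hp2 τ).2.1
      (by rw [abs_sub_comm, abs_of_nonneg (by linarith [hτ.2])]; linarith [hτ.1])
    have h := hfx τ ⟨hℓb.trans hτ.1, hτ.2⟩
    have h2 : ck * S * (1 + |τ - c| / ℓ) ^ p ≤ ck * S * 4 := mul_le_mul_of_nonneg_left hω hckS
    calc ‖f τ‖ ≤ M0 + ck * S * (1 + |τ - c| / ℓ) ^ p := h
      _ ≤ M0 + ck * S * 4 := by linarith
      _ = M := by simp only [hMdef]; ring
  have hfa : ∀ τ ∈ Icc b (c - ℓ), ‖f τ‖ ≤ M * ((c - τ) / (c - (c - ℓ))) ^ p := by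
    intro τ hτ
    have hwf := (weight_facts_ball (c := c) hℓ hp0 hp2 τ).2.2.2 hτ.2
    have hρ1 : 1 ≤ ((c - τ) / (c - (c - ℓ))) ^ p :=
      Real.one_le_rpow (by rw [show c - (c - ℓ) = ℓ by ring, le_div_iff₀ hℓ]; linarith [hτ.2]) hp0
    have h := hfx τ ⟨hτ.1, hτ.2.trans hec.le⟩
    have h2 : ck * S * (1 + |τ - c| / ℓ) ^ p ≤ ck * S * (4 * ((c - τ) / (c - (c - ℓ))) ^ p) := mul_le_mul_of_nonneg_left hwf.1 hckS
    have h3 : M0 ≤ M0 * ((c - τ) / (c - (c - ℓ))) ^ p := le_mul_of_one_le_right hM00 hρ1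
    calc ‖f τ‖ ≤ M0 + ck * S * (1 + |τ - c| / ℓ) ^ p := h
      _ ≤ M0 * ((c - τ) / (c - (c - ℓ))) ^ p + ck * S * (4 * ((c - τ) / (c - (c - ℓ))) ^ p) := add_le_add h3 h2
      _ = M * ((c - τ) / (c - (c - ℓ))) ^ p := by simp only [hMdef]; ring
  have hwneg' : ∀ τ ∈ Ico b c, w τ < 0 := fun τ hτ => hwneg τ ⟨hτ.1, hτ.2.le⟩ hτ.2
  have h := twoZone_norm_le_forced_var_left (z := z) (z' := z') (f := f) (α := β₁) (β := β₂) (β' := β₂') (G := 2 * G / q) (βmax := b₂)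
    (pf := p) hGq hM0' hβ₀ hb20 hec hℓb hw₁ hp0 le_rfl hz (fun τ _ => hβ₂ τ) hw.continuous hwc hwneg' hww₁ hode hfd hfa
    (fun τ _ => hb₂ τ) hsmall hgain hstag hgrow
  intro τ hτ
  have hw1 := (weight_facts_ball (c := c) hℓ hp0 hp2 τ).1
  rcases le_or_gt (c - ℓ) τ with h1 | h1
  · have hd := h.1 τ ⟨h1, hτ.2⟩
    refine hd.trans ?_
    have : K * M ≤ K * (β₀ * K) * M * (1 + |τ - c| / ℓ) ^ p := by
      have e : K * (β₀ * K) * M * (1 + |τ - c| / ℓ) ^ p = K * M * ((β₀ * K) * (1 + |τ - c| / ℓ) ^ p) := by ring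
      rw [e]
      have h2 : (1 : ℝ) ≤ (β₀ * K) * (1 + |τ - c| / ℓ) ^ p := one_le_mul_of_one_le_of_one_le hβ₀K hw1
      have h3 : 0 ≤ K * M := mul_nonneg hK0.le hM0'
      exact le_mul_of_one_le_right h3 h2
    simpa only [hKdef, hMdef] using this
  · have ha := h.2 τ ⟨hτ.1, h1.le⟩
    refine ha.trans ?_
    have hρω := ((weight_facts_ball (c := c) hℓ hp0 hp2 τ).2.2.2 h1.le).2
    have h3 : 0 ≤ K * (β₀ * K * M) := mul_nonneg hK0.le (mul_nonneg (mul_nonneg hβ₀.le hK0.le) hM0')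
    have := mul_le_mul_of_nonneg_right hρω h3
    have e : (1 + |τ - c| / ℓ) ^ p * (K * (β₀ * K * M)) = K * (β₀ * K) * M * (1 + |τ - c| / ℓ) ^ p := by ring
    rw [e] at this
    simpa only [hKdef, hMdef] using this

end Summit.NavierStokesRegularity.NavierStokesRegularity.Theorems.MatchedKernel

end
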